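import Summits.QuantumFields.BalabanUV.T4Continuum.Spine.NE3.EndLinesNonVacuous
import Summits.QuantumFields.YangMills.Theorems.BalabanUVNodesN16HolderMSEnd
import Summits.QuantumFields.YangMills.Theorems.BalabanUVNodesN16HolderMSPairDefs
import Summits.QuantumFields.BalabanUV.T4Continuum.Spine.NE3.PairLandauB8EndSfClassHP
import HarnessLib

/-!
# Route «BalabanUVNodes», cluster K4 «SpineRates» — node N16 = NE3: THE END OVER BAŁABAN's CLASS WITH THE MULTI-SCALE (3.40) HÖLDER MEMBER, NUMERIC LINES
# DISCHARGED (repair R-β″, PRODUCER HALF): `PairLandauGaugeB8AvgMS d (sfClass d L N ε) L N b g s₁ s₂ β dom` ([B8] Thm 2 + (1.37) at the pair, the Hölder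
# member MULTI-SCALE at its printed exponent) ∧ per-pair `LandauCorrectionSupB8` ∧ per-pair (P♮) on `slicB8` ⟹ `∃ C, CovRootHolderMS d (sfClass …) L N b g C s₁ s₂ β dom`

Cell `pub-ymgap`, seat `pub-ymgap-dag-n16-c` (R134 fan-out seat, strategy s1; HUMAN RULING D-0062; chair R424 venue), generation 4, file 27 — twin of generation 2's
file 10 `BalabanUVNodesN16HolderEndSfClass` with the third covariant conjunct MULTI-SCALE; over file 25 `BalabanUVNodesN16HolderMSEnd` (the junction) and file 26
`BalabanUVNodesN16HolderMSPairDefs` (the hypothesis shape).  `--supports stmt-QuantumFields-19912 --as helper` (K3‴ `SpineGivenEndpointR13`, route rev 16).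
`bears_on: R4∕N16 · edge N05 → N16`.  Located item: `HOME/pub-ymgap-dag-n16-c/LOCATED-N16-HOLDER-PIN.md`, census row R-β″ (ADDENDUM 5).

WHY.  Generation 2's file 10 re-ran THE END of the N16 chain of record (`…N16EndUniform`) at a generic Hölder exponent β: its per-pair suppliers
(`NE3.SupplierB8SfClassSizes.decomposedRepT_sfClass_of_landauRepB8Avg_towers`, `NE3.TangentProjectionSlicB8Class.tangentProjectionBound_slicB8_sfClass_family`,
`NE3CurlPairedResidualGaugeQuotient.curlPairedResidual_sfClass_of_tangentProjection`, `NE3EnergyChartLeaves.isUnitaryCfg_cavg_of_regular`) read the B8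
representative's `LandauRepB8Avg` part and none reads the third covariant conjunct, which THE END passes through.  The multi-scale B8 shape
`PairLandauGaugeB8AvgMS` (file 26) carries the same `LandauRepB8Avg … s₁ s₂ β` part plus the multi-scale member of the same `Z`; so THE END with the multi-scale
member is the SAME composition closed by file 25's junction `N16HolderMSEnd.covRoot_holderMS_of_pairLandauGaugeB8AvgMS`.  THIS FILE is generation 2's file 10
token for token with `PairLandauGaugeB8Avg ↦ PairLandauGaugeB8AvgMS` in the hypotheses and the conclusion `∃ C, CovRootHolderMS d (sfClass d L N ε) L N b g C s₁ s₂ β dom`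
(file 22's named multi-scale β-root) in place of the inline nearest-neighbour body.

WHAT THIS FILE PROVES (kernel, theorems only, 0 `def`, 0 sorry): §1 `covRoot_holderMS_sfClass_small_uniform` (numeric lines discharged, `r` uniform in `g`);
§2 `covRoot_holderMS_sfClass_small_of_leafH3sup_uniform` (the sup letter `hF5` discharged by N07's `LeafH3sup`); §3 `covRoot_holderMS_sfClass_small_of_lines_uniform`,
`covRoot_holderMS_sfClass_small_lineFree_uniform` ((P♮) by the owner's four k-free lines, the lines satisfiable); §4 `n16_holderMS_of_inEdges_uniform` (`d = 4`:
N05's multi-scale B8 shape ∧ N07's `LeafH3sup` ⟹ `∃ C, CovRootHolderMS 4 (sfClass 4 L N ε) L N b g C s₁ s₂ β dom`).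
HONEST FRAMING: kernel composition over landed modules of the pub-balaban ∕ pub-balaban-gaps NE3 lineages (their estimates, by name); the displayed inputs are
HYPOTHESES ([Balaban1985RegularSpaces] Thm 2 + (1.37) ∘ [Balaban1985Variational] Thm 1 TYPE at the pair; [Balaban1985BackgroundPropagators] (3.40), (3.42)∕(3.48)
and Thm 3.3 TYPES); nothing of Bałaban's proved; NE3 ∕ N16 NOT discharged; count-neutral; one finite four-torus at fixed ε — NOT ℝ⁴, NOT infinite volume, NOT OS,
NOT a mass gap, NOT Clay.
-/

set_option autoImplicit false

open scoped BigOperators Matrix Matrix.Norms.L2Operator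
open NormedSpace Finset

namespace Summit.QuantumFields.YangMills.BalabanUVNodes.N16HolderMSEndSfClass

open Set
open Literature.MathematicalPhysics.QuantumFieldTheory.Balaban1983to89
open B7Prop1Explicit B7Prop2Explicit
open T4AveragingDeficitWall (IsSkewDir IsUnitaryCfg SmallField Ad vary Plane)
open T4AveragingDeficitWallBoundary (IsPeriodicCfg periodBox)
open Summit.QuantumFields.BalabanUV.T4Continuum
open AveragingDeficitPeriodicCounting (IsPeriodicDir)
open AveragingDeficitChartCalculus (cavg)
open AveragingDeficitMultiLevelPrep (LevelSmall)
open AveragingDeficitTwoLevelPrep (twoLevelSmall)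
open MinimalActionSandwich (IsMinimiser)
open MinimalActionRate (Regular sfClass)
open NE3EnergyShapes (residualScale IsUnitarySite IsPeriodicSite)
open NE3EnergyWeightedShapes (energyNormW)
open NE3SlicePoincareShape (SlicePoincare)
open NE3EnergyRateWSupOfSlicePoincare (cLambda)
open NE3QbarIterCovLiftPrep (cruxC liftC liftC_nonneg)
open NE3RightInverseSolveLetters (thetaLoc)
open NE3ClassRadiusFamily (levelSmall_family)
open NE3EnergyChartLeaves (isUnitaryCfg_cavg_of_regular)
open NE3CurlPairedResidualGaugeQuotient (curlPairedResidual_sfClass_of_tangentProjection)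
open NE3.PairLandauB8Avg (LandauRepB8Avg PairLandauGaugeB8Avg slicB8)
open NE3.LandauProjectionSupShape (LandauCorrectionSupB8)
open NE3.SupplierB8SfClassSizes (decomposedRepT_sfClass_of_landauRepB8Avg_towers)
open NE3.TangentProjectionSlicB8Class (tangentProjectionBound_slicB8_sfClass_family)
open NE3.EndLinesNonVacuous (endLines_exists)
open MinimalActionRefine (RegularSup)
open BlockAverageCurrent (curConst curConst_nonneg)
open NE3RightInverseSolveLetters (cruxC_nonneg)
open NE3RightInverseSupLetters (frameC)
open NE3SlicePoincareBudgetLine (CPLine ShLine SmallYLine)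
open NE3CovariantLineSumsL2 (C2sq)
open NE3CovariantLineSumsL2Tower (rho)
open NE3.LeafIndexSockets (LeafH3sup)
open NE3.PairLandauB8EndSupFacts (cruxC_eps_le_half supFacts_const_le)
open NE3.SupRegularityCurvedUniform (one_le_frameC_add)
open NE3.PairLandauB8EndSfClassH3sup (hF5_of_leafH3sup)
open NE3.SlicePoincareCoulombN (CPLine_nonneg)
open NE3.PairLandauB8EndSfClassHP (slicePoincare_slicB8_cavg_of_regular ownerLines_exist)
open Summit.QuantumFields.YangMills.BalabanUVNodes.N16HolderMSEnd (covRoot_holderMS_of_pairLandauGaugeB8AvgMS)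
open Summit.QuantumFields.YangMills.BalabanUVNodes.N16HolderMSDefs (CovRootHolderMS)
open Summit.QuantumFields.YangMills.BalabanUVNodes.N16HolderMSPairDefs (PairLandauGaugeB8AvgMS)

noncomputable section

variable {d : ℕ} {n : Type*} [Fintype n] [DecidableEq n]

/-! ## §1 THE END at exponent `β`, numeric lines discharged -/

/-- **THE END OVER BAŁABAN's CLASS AT HÖLDER EXPONENT `β`, NUMERIC LINES DISCHARGED, `r` UNIFORM IN `g`** — `Thm/BalabanUVNodesN16EndUniform.
ne3EnergyRateWCov_sfClass_small_uniform` with the B8 shape at exponent `β` and the conclusion the β-root (`∃ C`; (Lip₁ᶜ) `s₁ξ²`, (Lip₂′ᶜ)_β `s₂ξ^{2+β}`).  Proof = the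
chain of record (`endLines_exists` letters; per pair `isUnitaryCfg_cavg_of_regular`, `decomposedRepT_sfClass_of_landauRepB8Avg_towers`,
`tangentProjectionBound_slicB8_sfClass_family`, `curlPairedResidual_sfClass_of_tangentProjection` — β-generic BY NAME) closed by file 9's junction. [folklore] -/
theorem covRoot_holderMS_sfClass_small_uniform [Nonempty n] (hd : 3 ≤ d) {L N : ℕ} [NeZero L] [NeZero N] (hL : 2 ≤ L) (hN : 1 ≤ N)
    {CP K₀ K₁ : ℝ} (hCP : 0 ≤ CP) (hK₀ : 0 ≤ K₀) (hK₁ : 0 ≤ K₁) :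
    ∃ r : ℝ, 0 < r ∧ ∀ ⦃g : ℝ⦄, 0 < g → ∀ ⦃ε s₁ b : ℝ⦄, 0 < ε → ε ≤ r → 0 ≤ s₁ → s₁ ≤ r → 0 ≤ b → b ≤ ε / 2 →
      ∀ (s₂ β : ℝ) {dom : _root_.Set (Site d → Fin d → (Matrix n n ℂ)ˣ)},
        PairLandauGaugeB8AvgMS d (sfClass d L N ε) L N b g s₁ s₂ β dom →
        (∀ j : ℕ, ∀ V ∈ dom, ∀ UB : Site d → Fin d → (Matrix n n ℂ)ˣ, IsMinimiser d (sfClass d L N ε) L N (j + 2) V UB →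
          Regular d L N b g (j + 2) UB → ∀ (hWu : IsUnitaryCfg (cavg L UB)) (hx : 0 ≤ ε / ((L : ℝ) ^ (j + 1)) ^ 2)
            (hs : LevelSmall d L j (ε / ((L : ℝ) ^ (j + 1)) ^ 2)) (hWx : SmallField (cavg L UB) (ε / ((L : ℝ) ^ (j + 1)) ^ 2))
            (hθ : cruxC d L * (((L : ℝ) ^ (j + 1)) ^ 2 * (ε / ((L : ℝ) ^ (j + 1)) ^ 2)) < 1), LandauCorrectionSupB8 hL j hWu hx hs hWx N hθ K₀ K₁) →
        (∀ j : ℕ, ∀ V ∈ dom, ∀ UB : Site d → Fin d → (Matrix n n ℂ)ˣ, IsMinimiser d (sfClass d L N ε) L N (j + 2) V UB →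
          Regular d L N b g (j + 2) UB → SlicePoincare L (j + 1) (cavg L UB) (slicB8 L N (j + 1) (cavg L UB)) CP (periodBox (N * L ^ (j + 1)))) →
        ∃ C : ℝ, CovRootHolderMS d (sfClass d L N ε) L N b g C s₁ s₂ β dom := by
  obtain ⟨r, hr0, hr⟩ := endLines_exists (n := n) d L N (le_trans (by norm_num) hL) K₀ K₁ hCP
  refine ⟨r, hr0, fun g hg ε s₁ b hε hεr hs₁ hs₁r hb hbh s₂ β dom hB8 hF5 hP => ?_⟩
  obtain ⟨α₀, P, Q, AN, Ac, ah, Λ, hbε, hε1, hbs, hbε', h1, h2, hθε, hθlε, hPsε, hα, hα3, hα4, hεα, hsmall, hc₃, hK, hS1, hP0, hQ0,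
    hPl, hQl, hAN, hAc, hah, hlines₁, hlineJ, hlineN, hlineα, hlineαN, hρ, hlineΛ, hlineCP, hreg₁, hbudget⟩ :=
    hr hε hεr hs₁ hs₁r hb hbh
  have hε0 : 0 ≤ ε := hε.le
  have hL1 : 1 ≤ L := le_trans one_le_two hL
  -- the letter `ν` of the towers chain (`…EndSfClassTowers`)
  have hν : 0 ≤ ((1 + 2048 * Real.sqrt (16 * d + 1)) * (2 * Real.sqrt ((2 * (liftC d / (1 - thetaLoc d L * ε)) ^ 2 + 8 * Fintype.card n * ((d : ℝ) * liftC d ^ 2 * (2 * (d : ℝ) + 8) ^ 2 / (1 - thetaLoc d L * ε) ^ 2)) + (2 * (4 * d * (liftC d * (17 + 16 * (d : ℝ))) ^ 2 / (1 - thetaLoc d L * ε) ^ 2) + 128 * Fintype.card (T4AveragingDeficitWall.Plane d) * Fintype.card n * ((d : ℝ) * liftC d ^ 2 * (2 * (d : ℝ) + 8) ^ 2 / (1 - thetaLoc d L * ε) ^ 2))) * P * s₁)) := by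
    have hlC := liftC_nonneg d
    have h1' : 0 ≤ 1 + 2048 * Real.sqrt (16 * (d : ℝ) + 1) := by positivity
    have h2' : 0 ≤ 2 * Real.sqrt ((2 * (liftC d / (1 - thetaLoc d L * ε)) ^ 2 + 8 * Fintype.card n * ((d : ℝ) * liftC d ^ 2 * (2 * (d : ℝ) + 8) ^ 2 / (1 - thetaLoc d L * ε) ^ 2)) + (2 * (4 * d * (liftC d * (17 + 16 * (d : ℝ))) ^ 2 / (1 - thetaLoc d L * ε) ^ 2) + 128 * Fintype.card (T4AveragingDeficitWall.Plane d) * Fintype.card n * ((d : ℝ) * liftC d ^ 2 * (2 * (d : ℝ) + 8) ^ 2 / (1 - thetaLoc d L * ε) ^ 2))) := by positivity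
    exact mul_nonneg h1' (mul_nonneg (mul_nonneg h2' hP0) hs₁)
  -- the constant of (RES♯) through the gauge quotient (`…EndSfClassR25` ∕ `…EndSfClass`)
  have hC0 : 0 ≤ Real.sqrt ((L : ℝ) ^ (d - 2))
      + (Real.sqrt ((L : ℝ) ^ (d - 2)) * Real.sqrt (8 * Fintype.card (T4AveragingDeficitWall.Plane d))
          * (128 * (d * (L : ℝ) ^ 2))
        + 2 * (2048 * ((d : ℝ) + 4) ^ 2 * (L : ℝ) ^ 2 * Real.sqrt (d * (L : ℝ) ^ d))) * b
      + b ^ 2 * (2 * (L : ℝ) ^ (d - 1) + 2 * (8 * d * (L : ℝ) ^ d)) * Real.sqrt (d / (g * (L : ℝ) ^ (d + 2))) := by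
    positivity
  have hK25 : 0 ≤ 1 + Real.sqrt (192 * ((d : ℝ) * L) * (d + Fintype.card (T4AveragingDeficitWall.Plane d))) := by positivity
  have hC' := mul_nonneg hK25 hC0
  have hsmallLv : ∀ j : ℕ, LevelSmall d L (j + 1) (ε / ((L : ℝ) ^ (j + 2)) ^ 2) := levelSmall_family hL hε0 h1 h2
  refine ⟨_, covRoot_holderMS_of_pairLandauGaugeB8AvgMS (le_trans (by norm_num) hd) hL1 hN hCP hreg₁ hν hC' hbudget hB8 ?_⟩
  intro k hk V hV UA UB hA hB hreg u Z hZ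
  obtain ⟨j, rfl⟩ : ∃ j, k = j + 1 := ⟨k - 1, by omega⟩
  have hW : IsUnitaryCfg (cavg L UB) := isUnitaryCfg_cavg_of_regular hL1 j hb hbε (hsmallLv j) hreg
  obtain ⟨X, Nn, α, αN, a, hdec, hΓ0, hα40, hαN100, hJ1, hJ2⟩ :=
    decomposedRepT_sfClass_of_landauRepB8Avg_towers hd hL hN hb hε0 hε1 hbs hbε' h1 h2 hθε hθlε hPsε hα hα3 hα4 hεα hs₁ hsmall hc₃ hK hS1 hP0 hQ0
      hPl hQl hK₀ hK₁ hCP hAN hAc hah hlines₁ hlineJ hlineN hlineα hlineαN hρ hlineΛ hlineCP j hA hB hreg hZ (hF5 j V hV UB hB hreg)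
  have hproj := tangentProjectionBound_slicB8_sfClass_family hd hL hN hb hε0 hε1 hbs hbε' h1 h2 j hreg
  have hres := curlPairedResidual_sfClass_of_tangentProjection (le_trans (by norm_num) hd) hL1 hN j hb hbε hg (hsmallLv j) hB hreg hproj
  rw [← mul_assoc] at hres
  exact ⟨hW, X, Nn, α, αN, a, hdec, hΓ0, hα40, hαN100, hJ1, hJ2, hP j V hV UB hB hreg, hres⟩

/-! ## §2 The sup letter discharged by N07's interface (H3ˢᵘᵖ), at exponent `β` -/

/-- **THE END AT EXPONENT `β` WITH THE SUP LETTER GONE, `r` UNIFORM IN `(g, b′, c′)`** — `Thm/BalabanUVNodesN16EndUniform.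
ne3EnergyRateWCov_sfClass_small_of_leafH3sup_uniform` with `1 ↦ β`: `PairLandauGaugeB8Avg d (sfClass d L N ε) L N b g s₁ s₂ β dom` ∧ `LeafH3sup d L N ε b′ c′ dom`
([Balaban1985Variational] Thm 1 (8)+(10) TYPE) ∧ per-pair (P♮) on `slicB8` (`CP`) ⟹ the β-root.  Same proof (the uniform majorants `K₀*`, `K₁*` and
`NE3.PairLandauB8EndSfClassH3sup.hF5_of_leafH3sup`), over §1. [folklore] -/
theorem covRoot_holderMS_sfClass_small_of_leafH3sup_uniform [Nonempty n] (hd : 3 ≤ d) {L N : ℕ} [NeZero L] [NeZero N] (hL : 2 ≤ L)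
    (hN : 1 ≤ N) {CP : ℝ} (hCP : 0 ≤ CP) :
    ∃ r : ℝ, 0 < r ∧ ∀ ⦃g b' c' : ℝ⦄, 0 < g → 0 ≤ b' → 0 ≤ c' →
      2 ^ 15 * ((d : ℝ) + 1) ^ 2 * ((d : ℝ) + 4) ^ 2 * (L : ℝ) ^ 2 * b' ≤ 1 →
      23040 * (d : ℝ) ^ 4 * (frameC d L + d) ^ 3 * (c' + curConst d L * b' ^ 2) ≤ 1 → ∀ ⦃ε s₁ b : ℝ⦄, 0 < ε → ε ≤ r → 0 ≤ s₁ → s₁ ≤ r → 0 ≤ b → b ≤ ε / 2 →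
      ∀ (s₂ β : ℝ) {dom : _root_.Set (Site d → Fin d → (Matrix n n ℂ)ˣ)},
        PairLandauGaugeB8AvgMS d (sfClass d L N ε) L N b g s₁ s₂ β dom →
        LeafH3sup d L N ε b' c' dom →
        (∀ j : ℕ, ∀ V ∈ dom, ∀ UB : Site d → Fin d → (Matrix n n ℂ)ˣ, IsMinimiser d (sfClass d L N ε) L N (j + 2) V UB → Regular d L N b g (j + 2) UB →
          SlicePoincare L (j + 1) (cavg L UB) (slicB8 L N (j + 1) (cavg L UB)) CP (periodBox (N * L ^ (j + 1)))) →
        ∃ C : ℝ, CovRootHolderMS d (sfClass d L N ε) L N b g C s₁ s₂ β dom := by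
  have hd1 : 1 ≤ d := le_trans (by norm_num) hd
  -- the level-free constant and the uniform majorants `K₀*`, `K₁*` of `K₀(ε)`, `K₁(ε)` (verbatim `…N16EndUniform`)
  obtain ⟨cR, hcR⟩ : ∃ K : ℝ, K = 1 + 2 * (Fintype.card n : ℝ) * (64 * (d : ℝ) ^ 2 * N) ^ d + 27 * (Fintype.card n : ℝ) ^ 3 * (512 : ℝ) ^ d * (N : ℝ) ^ d := ⟨_, rfl⟩
  have hcR0 : 0 ≤ cR := by rw [hcR]; positivity
  have hF0 : 0 ≤ frameC d L + d := le_trans zero_le_one (one_le_frameC_add hd1 L)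
  obtain ⟨K₀s, hK₀s⟩ : ∃ K : ℝ, K = 2 * ((d : ℝ) * liftC d * (36 * d * (frameC d L + d) ^ 2) * cR * (6 + 2 * ((d : ℝ) + 1))) := ⟨_, rfl⟩
  obtain ⟨K₁s, hK₁s⟩ : ∃ K : ℝ, K = 2 * ((d : ℝ) * liftC d * (36 * d * (frameC d L + d)) * cR * (6 + 2 * ((d : ℝ) + 1))) := ⟨_, rfl⟩
  have hK₀ : 0 ≤ K₀s := by rw [hK₀s]; have := liftC_nonneg d; positivity
  have hK₁ : 0 ≤ K₁s := by rw [hK₁s]; have := liftC_nonneg d; positivity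
  obtain ⟨r, hr0, hr⟩ := covRoot_holderMS_sfClass_small_uniform (n := n) hd hL hN (CP := CP) hCP hK₀ hK₁
  have hc := cruxC_nonneg d L
  have hρ0 : 0 < 1 / (2 * cruxC d L + 2) := by positivity
  have hF1 : (1 : ℝ) ≤ frameC d L + d := one_le_frameC_add hd1 L
  have hF2 : 0 < 23040 * (d : ℝ) ^ 4 * (frameC d L + d) ^ 2 := by have : (0 : ℝ) < d := (by exact_mod_cast hd1); positivity
  have hσ0 : 0 < 1 / (23040 * (d : ℝ) ^ 4 * (frameC d L + d) ^ 2) := by positivity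
  refine ⟨min r (min (1 / (2 * cruxC d L + 2)) (1 / (23040 * (d : ℝ) ^ 4 * (frameC d L + d) ^ 2))), lt_min hr0 (lt_min hρ0 hσ0),
    fun g b' c' hg hb' hc' hRb hcF ε s₁ b hε hεr hs₁ hs₁r hb hbh s₂ β dom hB8 h3 hP => ?_⟩
  have hεr' : ε ≤ r := hεr.trans (min_le_left _ _)
  have hs₁r' : s₁ ≤ r := hs₁r.trans (min_le_left _ _)
  obtain ⟨hcε, hε1⟩ := cruxC_eps_le_half d L hε.le (hεr.trans ((min_le_right _ _).trans (min_le_left _ _)))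
  have hεF : 23040 * (d : ℝ) ^ 4 * (frameC d L + d) ^ 2 * ε ≤ 1 := by
    have h1 : ε ≤ 1 / (23040 * (d : ℝ) ^ 4 * (frameC d L + d) ^ 2) := hεr.trans ((min_le_right _ _).trans (min_le_right _ _))
    rw [le_div_iff₀ hF2] at h1; linarith
  -- `K(ε) ≤ K*`
  have hle₀ : (d : ℝ) * liftC d * (6 + 2 * ((d : ℝ) + 1) * ε) * (36 * d * (frameC d L + d) ^ 2)
        * (1 + 2 * (Fintype.card n : ℝ) * (64 * (d : ℝ) ^ 2 * N) ^ d + 27 * (Fintype.card n : ℝ) ^ 3 * (512 : ℝ) ^ d * (N : ℝ) ^ d) / (1 - cruxC d L * ε) ≤ K₀s := by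
    rw [← hcR, hK₀s]
    have hA : 0 ≤ (d : ℝ) * liftC d * (36 * d * (frameC d L + d) ^ 2) * cR := by have := liftC_nonneg d; positivity
    have key := supFacts_const_le d L hA hε.le hε1 hcε
    calc (d : ℝ) * liftC d * (6 + 2 * ((d : ℝ) + 1) * ε) * (36 * d * (frameC d L + d) ^ 2) * cR / (1 - cruxC d L * ε)
        = (d : ℝ) * liftC d * (36 * d * (frameC d L + d) ^ 2) * cR * (6 + 2 * ((d : ℝ) + 1) * ε) / (1 - cruxC d L * ε) := by ring
      _ ≤ 2 * ((d : ℝ) * liftC d * (36 * d * (frameC d L + d) ^ 2) * cR * (6 + 2 * ((d : ℝ) + 1))) := key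
  have hle₁ : (d : ℝ) * liftC d * (6 + 2 * ((d : ℝ) + 1) * ε) * (36 * d * (frameC d L + d))
        * (1 + 2 * (Fintype.card n : ℝ) * (64 * (d : ℝ) ^ 2 * N) ^ d + 27 * (Fintype.card n : ℝ) ^ 3 * (512 : ℝ) ^ d * (N : ℝ) ^ d) / (1 - cruxC d L * ε) ≤ K₁s := by
    rw [← hcR, hK₁s]
    have hA : 0 ≤ (d : ℝ) * liftC d * (36 * d * (frameC d L + d)) * cR := by have := liftC_nonneg d; positivity
    have key := supFacts_const_le d L hA hε.le hε1 hcε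
    calc (d : ℝ) * liftC d * (6 + 2 * ((d : ℝ) + 1) * ε) * (36 * d * (frameC d L + d)) * cR / (1 - cruxC d L * ε)
        = (d : ℝ) * liftC d * (36 * d * (frameC d L + d)) * cR * (6 + 2 * ((d : ℝ) + 1) * ε) / (1 - cruxC d L * ε) := by ring
      _ ≤ 2 * ((d : ℝ) * liftC d * (36 * d * (frameC d L + d)) * cR * (6 + 2 * ((d : ℝ) + 1))) := key
  exact hr hg hε hεr' hs₁ hs₁r' hb hbh s₂ β hB8 (hF5_of_leafH3sup hd1 hL h3 hb' hc' hRb hεF hcF hle₀ hle₁) hP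

/-! ## §3 (P♮) discharged by the owner's four k-free lines, at exponent `β`; the lines satisfiable -/

/-- **THE END AT EXPONENT `β` WITH THE SLICE-POINCARÉ BINDER GONE, `r` UNIFORM IN `(g, b′, c′)`** — `Thm/BalabanUVNodesN16EndUniform.
ne3EnergyRateWCov_sfClass_small_of_lines_uniform` with `1 ↦ β` (the owner swarm's four k-free lines on `(θ, εc)`; (P♮) on `slicB8` by
`NE3.PairLandauB8EndSfClassHP.slicePoincare_slicB8_cavg_of_regular`).  Same proof, over §2. [folklore] -/
theorem covRoot_holderMS_sfClass_small_of_lines_uniform [Nonempty n] (hd : 3 ≤ d) {L N : ℕ} [NeZero L] [NeZero N] (hL : 2 ≤ L) (hN : 1 ≤ N)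
    {θ εc : ℝ} (hθ : 0 < θ) (hεc : 0 < εc)
    (h1 : ShLine d L (Fintype.card n) εc θ ≤ 1 / 2) (h2 : SmallYLine d L (Fintype.card n) εc θ ≤ 1 / 2)
    (h3 : 68 / 3 * (((d : ℝ) + 1) * ((d : ℝ) + 4)) * C2sq d L * θ ≤ rho d L / 2)
    (h4 : 8 * d * (((d : ℝ) - 1) * θ) ^ 2
      + 2 * ((Fintype.card n : ℝ) * ((4 * (d : ℝ) ^ 2 + 272 * d * (((d : ℝ) + 1) * ((d : ℝ) + 4))) * θ) ^ 2) ≤ 1 / 2) :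
    ∃ r : ℝ, 0 < r ∧ ∀ ⦃g b' c' : ℝ⦄, 0 < g → 0 ≤ b' → 0 ≤ c' →
      2 ^ 15 * ((d : ℝ) + 1) ^ 2 * ((d : ℝ) + 4) ^ 2 * (L : ℝ) ^ 2 * b' ≤ 1 →
      23040 * (d : ℝ) ^ 4 * (frameC d L + d) ^ 3 * (c' + curConst d L * b' ^ 2) ≤ 1 →
      ∀ ⦃ε s₁ b : ℝ⦄, 0 < ε → ε ≤ r → 0 ≤ s₁ → s₁ ≤ r → 0 ≤ b → b ≤ ε / 2 →
      ∀ (s₂ β : ℝ) {dom : _root_.Set (Site d → Fin d → (Matrix n n ℂ)ˣ)},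
        PairLandauGaugeB8AvgMS d (sfClass d L N ε) L N b g s₁ s₂ β dom →
        LeafH3sup d L N ε b' c' dom →
        ∃ C : ℝ, CovRootHolderMS d (sfClass d L N ε) L N b g C s₁ s₂ β dom := by
  have hd1 : 1 ≤ d := by omega
  have hdm : (0 : ℝ) ≤ (d : ℝ) - 1 := by
    have h1r : (1 : ℝ) ≤ d := by exact_mod_cast hd1
    linarith
  -- the k-free slice constant
  obtain ⟨δW, hδW⟩ : ∃ D : ℝ, D = (2 + 32 * (8 * (Fintype.card n : ℝ) * d * (1 + 2 * (((d : ℝ) - 1) * θ)) ^ 2 * (2 * (8 : ℝ) ^ d) ^ 2))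
      * (8 * (Fintype.card n : ℝ) * d * (1 + 2 * (((d : ℝ) - 1) * θ)) ^ 2 * (2 * (8 : ℝ) ^ d) ^ 2) := ⟨_, rfl⟩
  have hδW0 : 0 ≤ δW := by
    rw [hδW]
    have : 0 ≤ 1 + 2 * (((d : ℝ) - 1) * θ) := by have := mul_nonneg hdm hθ.le; linarith
    positivity
  have hCPL : 0 ≤ CPLine d L (Fintype.card n) εc θ := CPLine_nonneg hd1 L (by positivity) hεc.le hθ.le
  obtain ⟨CP, hCP⟩ : ∃ C : ℝ, C = 4 * (Fintype.card n : ℝ) * (69 + 2 * δW) * CPLine d L (Fintype.card n) εc θ := ⟨_, rfl⟩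
  have hCP0 : 0 ≤ CP := by rw [hCP]; positivity
  obtain ⟨r, hr0, hr⟩ := covRoot_holderMS_sfClass_small_of_leafH3sup_uniform (n := n) hd hL hN hCP0
  -- the ε-radii of the lines absorbed into `r`
  obtain ⟨A, hA⟩ : ∃ A : ℝ, A = 128 * (69 + 2 * δW) * CPLine d L (Fintype.card n) εc θ * (Fintype.card (Plane d) : ℝ) * (Fintype.card n : ℝ) := ⟨_, rfl⟩
  have hA0 : 0 ≤ A := by rw [hA]; positivity
  obtain ⟨B₁, hB₁⟩ : ∃ B : ℝ, B = 16 * (14464 * ((d : ℝ) + 1) ^ 2 * ((d : ℝ) + 4) ^ 2) := ⟨_, rfl⟩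
  have hB₁0 : 0 < B₁ := by rw [hB₁]; positivity
  obtain ⟨B₂, hB₂⟩ : ∃ B : ℝ, B = 2 * twoLevelSmall d L := ⟨_, rfl⟩
  have hB₂0 : 0 < B₂ := by rw [hB₂]; unfold twoLevelSmall; positivity
  obtain ⟨B₃, hB₃⟩ : ∃ B : ℝ, B = 512 * ((d : ℝ) + 1) * ((d : ℝ) + 4) * (L : ℝ) ^ 2 := ⟨_, rfl⟩
  have hB₃0 : 0 < B₃ := by rw [hB₃]; positivity
  obtain ⟨B₄, hB₄⟩ : ∃ B : ℝ, B = 226 * (8 * ((d : ℝ) + 1) * ((d : ℝ) + 4)) ^ 2 := ⟨_, rfl⟩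
  have hB₄0 : 0 < B₄ := by rw [hB₄]; positivity
  have hL2 : (0 : ℝ) < (L : ℝ) ^ 2 := by positivity
  refine ⟨min r (min θ (min (1 / (A + 1)) (min (3 / B₁) (min ((L : ℝ) ^ 2 / B₂) (min (1 / B₃) (2 / B₄)))))),
    lt_min hr0 (lt_min hθ (lt_min (by positivity) (lt_min (by positivity) (lt_min (by positivity) (lt_min (by positivity) (by positivity)))))),
    fun g b' c' hg hb' hc' hRb hcF ε s₁ b hε hεr hs₁ hs₁r hb hbh s₂ β dom hB8 h3L => ?_⟩
  have hεr' : ε ≤ r := hεr.trans (min_le_left _ _)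
  have hεθ : ε ≤ θ := hεr.trans ((min_le_right _ _).trans (min_le_left _ _))
  have hεA : ε ≤ 1 / (A + 1) := hεr.trans ((min_le_right _ _).trans ((min_le_right _ _).trans (min_le_left _ _)))
  have hε1 : ε ≤ 3 / B₁ := hεr.trans ((min_le_right _ _).trans ((min_le_right _ _).trans ((min_le_right _ _).trans (min_le_left _ _))))
  have hε2 : ε ≤ (L : ℝ) ^ 2 / B₂ :=
    hεr.trans ((min_le_right _ _).trans ((min_le_right _ _).trans ((min_le_right _ _).trans ((min_le_right _ _).trans (min_le_left _ _)))))
  have hε3 : ε ≤ 1 / B₃ :=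
    hεr.trans ((min_le_right _ _).trans ((min_le_right _ _).trans ((min_le_right _ _).trans ((min_le_right _ _).trans ((min_le_right _ _).trans (min_le_left _ _))))))
  have hε4 : ε ≤ 2 / B₄ :=
    hεr.trans ((min_le_right _ _).trans ((min_le_right _ _).trans ((min_le_right _ _).trans ((min_le_right _ _).trans ((min_le_right _ _).trans (min_le_right _ _))))))
  have hs₁r' : s₁ ≤ r := hs₁r.trans (min_le_left _ _)
  -- the lines at this `ε`
  have hf1 : 16 * (14464 * ((d : ℝ) + 1) ^ 2 * ((d : ℝ) + 4) ^ 2) * ε ≤ 3 := by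
    rw [← hB₁]; rw [le_div_iff₀ hB₁0] at hε1; linarith
  have hf2 : 2 * twoLevelSmall d L * ε ≤ (L : ℝ) ^ 2 := by
    rw [← hB₂]; rw [le_div_iff₀ hB₂0] at hε2; linarith
  have hbs : 512 * (d + 1) * (d + 4) * (L : ℝ) ^ 2 * b ≤ 1 := by
    have h1' : B₃ * ε ≤ 1 := by rw [le_div_iff₀ hB₃0] at hε3; linarith
    have : B₃ * b ≤ B₃ * ε := mul_le_mul_of_nonneg_left (by linarith) hB₃0.le
    rw [hB₃] at this h1'
    linarith
  have hbε' : b + 226 * (8 * (d + 1) * (d + 4)) ^ 2 * b ^ 2 ≤ ε := by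
    have hB4ε : B₄ * ε ≤ 2 := by rw [le_div_iff₀ hB₄0] at hε4; linarith
    have hb2 : b ^ 2 ≤ (ε / 2) ^ 2 := pow_le_pow_left₀ hb hbh 2
    have : B₄ * b ^ 2 ≤ ε / 2 := by
      calc B₄ * b ^ 2 ≤ B₄ * (ε / 2) ^ 2 := mul_le_mul_of_nonneg_left hb2 hB₄0.le
        _ = (B₄ * ε) * ε / 4 := by ring
        _ ≤ 2 * ε / 4 := by
            have := mul_le_mul_of_nonneg_right hB4ε hε.le
            linarith
        _ = ε / 2 := by ring
    rw [hB₄] at this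
    linarith
  have h6 : 128 * (69 + 2 * ((2 + 32 * (8 * (Fintype.card n : ℝ) * d * (1 + 2 * (((d : ℝ) - 1) * θ)) ^ 2 * (2 * (8 : ℝ) ^ d) ^ 2))
              * (8 * (Fintype.card n : ℝ) * d * (1 + 2 * (((d : ℝ) - 1) * θ)) ^ 2 * (2 * (8 : ℝ) ^ d) ^ 2)))
        * CPLine d L (Fintype.card n) εc θ * (Fintype.card (Plane d) : ℝ) * (Fintype.card n : ℝ) * ε ^ 2 ≤ 1 := by
    rw [← hδW, ← hA]
    have hA1 : 0 < A + 1 := by linarith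
    have hεA' : ε * (A + 1) ≤ 1 := by rwa [le_div_iff₀ hA1] at hεA
    have hε1' : ε ≤ 1 := by
      have : ε ≤ ε * (A + 1) := le_mul_of_one_le_right hε.le (by linarith)
      linarith
    have t1 : A * ε * ε ≤ A * ε * 1 := mul_le_mul_of_nonneg_left hε1' (by positivity)
    calc A * ε ^ 2 = A * ε * ε := by ring
      _ ≤ A * ε * 1 := t1
      _ ≤ ε * (A + 1) := by linarith [hε.le]
      _ ≤ 1 := hεA'
  refine hr hg hb' hc' hRb hcF hε hεr' hs₁ hs₁r' hb hbh s₂ β hB8 h3L ?_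
  intro j V _ UB _ hreg
  have hP := slicePoincare_slicB8_cavg_of_regular hd hL hN hb hε hεθ hεc hbs hbε' hf1 hf2 h1 h2 h3 h4 h6 j hreg
  rw [← hδW, ← hCP] at hP
  exact hP

/-- **THE END OF RECORD AT EXPONENT `β` — NO NUMERIC LINE BUT THE TWO LEAF LINES, `r` UNIFORM IN `(g, b′, c′)`** (`3 ≤ d`, `2 ≤ L`, `1 ≤ N`):
`Thm/BalabanUVNodesN16EndUniform.ne3EnergyRateWCov_sfClass_small_lineFree_uniform` with `1 ↦ β` — `PairLandauGaugeB8Avg d (sfClass d L N ε) L N b g s₁ s₂ β dom`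
([B8] Thm 2 + (1.37) ∘ [B11] Thm 1 TYPE at the pair, Hölder member at ANY exponent) ∧ `LeafH3sup d L N ε b′ c′ dom` ⟹ the β-root.  §3 with `(θ, εc)` from
`NE3.PairLandauB8EndSfClassHP.ownerLines_exist`. [folklore] -/
theorem covRoot_holderMS_sfClass_small_lineFree_uniform [Nonempty n] (hd : 3 ≤ d) {L N : ℕ} [NeZero L] [NeZero N] (hL : 2 ≤ L) (hN : 1 ≤ N) :
    ∃ r : ℝ, 0 < r ∧ ∀ ⦃g b' c' : ℝ⦄, 0 < g → 0 ≤ b' → 0 ≤ c' →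
      2 ^ 15 * ((d : ℝ) + 1) ^ 2 * ((d : ℝ) + 4) ^ 2 * (L : ℝ) ^ 2 * b' ≤ 1 →
      23040 * (d : ℝ) ^ 4 * (frameC d L + d) ^ 3 * (c' + curConst d L * b' ^ 2) ≤ 1 → ∀ ⦃ε s₁ b : ℝ⦄, 0 < ε → ε ≤ r → 0 ≤ s₁ → s₁ ≤ r → 0 ≤ b → b ≤ ε / 2 →
      ∀ (s₂ β : ℝ) {dom : _root_.Set (Site d → Fin d → (Matrix n n ℂ)ˣ)},
        PairLandauGaugeB8AvgMS d (sfClass d L N ε) L N b g s₁ s₂ β dom →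
        LeafH3sup d L N ε b' c' dom →
        ∃ C : ℝ, CovRootHolderMS d (sfClass d L N ε) L N b g C s₁ s₂ β dom := by
  obtain ⟨θ, εc, hθ, hεc, h1, h2, h3, h4⟩ := ownerLines_exist d (L := L) (by omega) (c := (Fintype.card n : ℝ)) (by positivity)
  exact covRoot_holderMS_sfClass_small_of_lines_uniform hd hL hN hθ hεc h1 h2 h3 h4

/-! ## §4 The `d = 4` instance: N16 ∕ NE3's two in-edge interfaces ⟹ the β-root, radius first -/

/-- **N16 · NE3 AT HÖLDER EXPONENT `β` FROM ITS IN-EDGES, RADIUS FIRST** (`d = 4`; `L ≥ 2`, `N ≥ 1`): `…N16EndUniform.n16_of_inEdges_uniform` with `1 ↦ β` —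
`PairLandauGaugeB8Avg 4 (sfClass 4 L N ε) L N b g s₁ s₂ β dom` (N05: [B8] Thm 2 + (1.37) at the pair, Hölder member at exponent `β` — printed for `β ≤ β₀ < 1`) ∧
`LeafH3sup 4 L N ε b′ c′ dom` (N07) ⟹ the covariant root's body with (Lip₂′ᶜ) at `s₂·ξ^{2+β}`.  THE END of the repair R-β on N16's side; N16 ∕ NE3 NOT proved (the
two interfaces are hypotheses). [folklore] -/
theorem n16_holderMS_of_inEdges_uniform [Nonempty n] {L N : ℕ} (hL : 2 ≤ L) (hN : 1 ≤ N) :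
    ∃ r : ℝ, 0 < r ∧ ∀ ⦃g b' c' : ℝ⦄, 0 < g → 0 ≤ b' → 0 ≤ c' →
      2 ^ 15 * ((4 : ℝ) + 1) ^ 2 * ((4 : ℝ) + 4) ^ 2 * (L : ℝ) ^ 2 * b' ≤ 1 →
      23040 * (4 : ℝ) ^ 4 * (frameC 4 L + 4) ^ 3 * (c' + curConst 4 L * b' ^ 2) ≤ 1 →
      ∀ ⦃ε s₁ b : ℝ⦄, 0 < ε → ε ≤ r → 0 ≤ s₁ → s₁ ≤ r → 0 ≤ b → b ≤ ε / 2 →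
      ∀ (s₂ β : ℝ) {dom : _root_.Set (Site 4 → Fin 4 → (Matrix n n ℂ)ˣ)},
        PairLandauGaugeB8AvgMS 4 (sfClass 4 L N ε) L N b g s₁ s₂ β dom →
        LeafH3sup 4 L N ε b' c' dom →
        ∃ C : ℝ, CovRootHolderMS 4 (sfClass 4 L N ε) L N b g C s₁ s₂ β dom := by
  haveI : NeZero L := NeZero.of_pos (by omega); haveI : NeZero N := NeZero.of_pos (by omega)
  obtain ⟨r, hr0, hr⟩ := covRoot_holderMS_sfClass_small_lineFree_uniform (d := 4) (n := n) (by norm_num) hL hN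
  refine ⟨r, hr0, fun g b' c' hg hb' hc' hRb hcF => ?_⟩
  exact hr hg hb' hc' (by simpa only [Nat.cast_ofNat] using hRb) (by simpa only [Nat.cast_ofNat] using hcF)

end

end Summit.QuantumFields.YangMills.BalabanUVNodes.N16HolderMSEndSfClass
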